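import Summits.BirchSwinnertonDyer.Rank1Residual.X11b.CoinvariantsLocal
import Summits.BirchSwinnertonDyer.Rank1Residual.X11b.ProcyclicDescentRescaled
import Summits.BirchSwinnertonDyer.Rank1Residual.X11b.BDPRouteControlStrictPlace
import Literature.NumberTheory.EllipticCurves.IwasawaGeneratorChangeProofs
import HarnessLib

/-!
# X11b, route R1 — atom (L10), descent step: `y₀` with `conj_γ y₀ − y₀ = x`, its conjugates
# modulo `Sel`, and the local lifts `Ψ_v ∈ H¹(D_v, E[p^∞])` (JSW17 Lemma 3.3.3, second half)

HONEST FRAMING (cell `b2b-bsdres`, run/shared/lean/b2b/bsd-rank1-residual/, verbatim in every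
file): the goal of the cell is to DELETE the COMBINATION-SHAPED residual classes of the
Birch–Swinnerton-Dyer formula for ALL analytic-rank `≤ 1` elliptic curves over `ℚ` — "full BSD
formula for every rank `≤ 1` curve in class `C`" assembled STRICTLY from published theorems — so
that the rank-`≤ 1` remainder becomes exactly the CONSTRUCTION-SHAPED classes, which are TYPED
(missing-input `Prop`s), NOT attempted. This is not "finishing BSD". Sub-cell
`b2b-bsdres-multr1-p1` (X11b, route R1 = Castella 2018 Thm. A re-proved along the author's
erratum); a RESEARCH ROUTE; no claim beyond the stated class; X11b stays CONSTRUCTION-SHAPED;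
nothing here changes a label; no named fact is minted (theorems only; no `sorry`).

## What this file does

For an elliptic curve `W` over a number field `K`, a `ℤ_p`-extension `κ` (`H = ker κ`) with
topological generator `γ`, `M = E[p^∞] = W.geomPrimaryTorsion p` and Castella's
`Sel = Sel_𝔭^Σ(K_∞, E[p^∞]) = AcSelmer.selmerAc W p κ 𝔭 Σ ⊆ H¹(H, M)`:

* `exists_conjH1_sub_eq_of_subsingleton` —
  **`H²(K, E[p^∞]) = 0 ⟹ H¹(H, M) = (conj_γ − 1) H¹(H, M)`** (the engine
  `ProcyclicDescent.exists_conjH1_sub_eq_of_subsingleton` at `G = Γ_K`);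
* `conjH1_sub_mem_selmerAc_of_isTopGenerator` — if `conj_γ y − y ∈ Sel` then `conj_g y − y ∈ Sel`
  for EVERY `g ∈ Γ_K` (a layer subgroup fixes `y`, `exists_forall_mem_layerSubgroup_conjH1_eq`;
  `Γ_K = ⋃ Gal(K̄/K_a) γ^k`; induction on `k`);
* `exists_resSubgroup_kerD_eq` — **the local lift**: for such `y` and a finite place `v` at which
  `Sel` imposes the away/strict condition (`v ∤ p`, `v ∉ Σ`, or `v = 𝔭`), `res_{H ∩ D_v} y` is
  `D_v`-invariant, hence (engine (c) on the profinite group `D_v` with `κ|_{D_v}`) the restriction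
  of some `Ψ_v ∈ H¹(D_v, M)`;
* `eq_zero_of_inertia_le` — at a good `v ∤ p` whose inertia group lies in the zero set of the
  cocycle of `y`, `Ψ_v = 0` and `res_{H ∩ D_v} y = 0` (gen 11's
  `H¹(D_v, E[p^∞]) ↪ H¹(I_v, E[p^∞])`);
* `conjH1_resSubgroup` (restricted classes are `Γ_K`-invariant) and `mem_infKer_of_decompInf_eq_bot`
  (complex places impose nothing).

References: [JetchevSkinnerWan2017] Lemma 3.3.3 (arXiv:1512.06894 pp. 11–12); [GreenbergLNM1716]
§3 Lemma 3.3; [Castella2018] Def. 2.2, Thm. 2.3 (arXiv:1704.06608 p. 5).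
-/

noncomputable section

open scoped Classical

open CategoryTheory Function Field NumberField IsDedekindDomain
open Literature.NumberTheory.GaloisRepresentations Literature.NumberTheory.EllipticCurves
open Literature.NumberTheory.EllipticCurves.GreenbergSelmer

namespace Summit.BirchSwinnertonDyer.Rank1Residual.X11b.Coinv

open Summit.BirchSwinnertonDyer.Rank1Residual.X11b.ProcyclicDescent (kerK)
open Summit.BirchSwinnertonDyer.Rank1Residual.X11b.LocBridge
open Summit.BirchSwinnertonDyer.Rank1Residual.X11b.AcSelmer

variable {K : Type} [Field K] [NumberField K] (W : WeierstrassCurve K) (p : ℕ) [Fact p.Prime]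
  (κ : ZpExtension K p)

/-! ## §1. Generalities -/

omit [NumberField K] [Fact p.Prime] in
/-- `E[p^∞]` is `p`-primary torsion. [folklore] -/
theorem isPrimaryTorsion_geomPrimaryTorsion : IsPrimaryTorsion p (W.geomPrimaryTorsion p) := fun Q ↦
  (AddCommGroup.mem_primaryComponent.mp Q.2).imp fun k hk ↦
    Subtype.ext (by rw [AddSubmonoidClass.coe_nsmul, hk, ZeroMemClass.coe_zero])

/-- The decomposition group `D_v ≤ Γ_K` is closed (image of the compact `Γ_{K_v}`). [folklore] -/
theorem isClosed_decomp (v : HeightOneSpectrum (𝓞 K)) :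
    IsClosed ((decomp v : Subgroup (absoluteGaloisGroup K)) : Set (absoluteGaloisGroup K)) := by
  haveI : CompactSpace (absoluteGaloisGroup (v.adicCompletion K)) :=
    absoluteGaloisGroup_compactSpace _
  exact (isCompact_range (absGaloisRestrict K (v.adicCompletion K)).continuous).isClosed

omit [NumberField K] in
/-- `Γ_K = Gal(K̄/K_n) · γ^ℕ`: every `g` is `h γ^k` with `h ∈ κ⁻¹(p^n ℤ_p)`, `k ∈ ℕ`
(`k = κ(g) mod p^n`, `PadicInt.appr`). [cite: Washington1997, §13.1] -/
theorem exists_mem_layerSubgroup_mul_pow {γ : absoluteGaloisGroup K} (hγ : κ.IsTopGenerator γ)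
    (n : ℕ) (g : absoluteGaloisGroup K) :
    ∃ h ∈ κ.layerSubgroup n, ∃ k : ℕ, g = h * γ ^ k := by
  set x : ℤ_[p] := (κ g).toAdd with hx
  refine ⟨g * (γ ^ x.appr n)⁻¹, ?_, x.appr n, by rw [inv_mul_cancel_right]⟩
  rw [ZpExtension.mem_layerSubgroup, map_mul, map_inv, toAdd_mul, toAdd_inv, map_pow,
    show κ γ = Multiplicative.ofAdd 1 from hγ, ← ofAdd_nsmul, toAdd_ofAdd, nsmul_eq_mul, mul_one,
    ← sub_eq_add_neg]
  exact Ideal.mem_span_singleton.mp (PadicInt.appr_spec n x)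

omit [NumberField K] in
/-- **Restricted classes are `Γ_K`-invariant**: `conj_σ (res_{Γ_K → H} g) = res g`.
[cite: SerreGaloisCohomology1997, I §2.5] -/
theorem conjH1_resSubgroup {M : Type} [AddCommGroup M] [DistribMulAction (absoluteGaloisGroup K) M]
    [TopologicalSpace M] [DiscreteTopology M] (H : Subgroup (absoluteGaloisGroup K)) [H.Normal]
    (σ : absoluteGaloisGroup K) (g : discreteH1 (absoluteGaloisGroup K) M) :
    conjH1 H M σ (ResKernel.resSubgroup H M g) = ResKernel.resSubgroup H M g := by
  rw [← ProcyclicDescent.resOfLe_comp_resSubgroup (A := M) (le_top : H ≤ ⊤),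
    AddMonoidHom.comp_apply, conjH1_resOfLe_of_mem M le_top (Subgroup.mem_top σ)]

omit [NumberField K] in
/-- **Complex places impose nothing**: if `decompInf w = ⊥` then every class of `H¹(H, M)` lies in
`infKer H M w` (`H¹` of the trivial group vanishes).
[cite: GreenbergLNM1716, §3 p. 87 (archimedean primes)] -/
theorem mem_infKer_of_decompInf_eq_bot {M : Type} [AddCommGroup M]
    [DistribMulAction (absoluteGaloisGroup K) M] [TopologicalSpace M] [DiscreteTopology M]
    {H : Subgroup (absoluteGaloisGroup K)} (w : InfinitePlace K) (hw : decompInf w = ⊥)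
    (c : subgroupH1 H M) : c ∈ infKer H M w := by
  rw [infKer, AddMonoidHom.mem_ker]
  obtain ⟨ψ, hψ⟩ := oneCocycleClass_surjective _ (resOfLe M (inf_le_left : H ⊓ decompInf w ≤ H) c)
  rw [← hψ]
  have h0 : ψ = 0 := by
    apply Subtype.ext
    ext x
    have hx : x = 1 := by
      apply Subtype.ext
      have h : (x : absoluteGaloisGroup K) ∈ (⊥ : Subgroup (absoluteGaloisGroup K)) := by
        rw [← hw]; exact (Subgroup.mem_inf.mp x.2).2
      exact Subgroup.mem_bot.mp h
    rw [hx]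
    exact contOneCocycles.apply_one ψ
  rw [h0, oneCocycleClass_zero]

/-! ## §2. `y₀` with `conj_γ y₀ − y₀ = x`; all conjugates of `y₀` modulo `Sel` -/

omit [NumberField K] in
/-- **`H²(K, E[p^∞]) = 0 ⟹ conj_γ − 1` is onto `H¹(K_∞, E[p^∞])`** (JSW17 Lemma 3.3.3, first half:
"`H¹(K, M)_Γ ↪ H²(K, W)`", in the `K_∞`-formulation): the procyclic-descent engine at `G = Γ_K`,
`A = E[p^∞]`. [cite: JetchevSkinnerWan2017, Lemma 3.3.3 (arXiv:1512.06894 pp. 11–12)] -/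
theorem exists_conjH1_sub_eq_of_subsingleton
    (h2 : Subsingleton (galoisCohomology (primaryGaloisModule W p) 2))
    {γ : absoluteGaloisGroup K} (hγ : κ.IsTopGenerator γ) (x : W.subgroupH1 p κ.kerSubgroup) :
    ∃ y : W.subgroupH1 p κ.kerSubgroup, W.conjH1 p κ.kerSubgroup γ y - y = x := by
  haveI : CompactSpace (absoluteGaloisGroup K) := absoluteGaloisGroup_compactSpace K
  exact ProcyclicDescent.exists_conjH1_sub_eq_of_subsingleton
    (isOpen_stabilizer_geomPrimaryTorsion W p) γ κ.toContinuousMonoidHom κ.surjective hγ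
    (isPrimaryTorsion_geomPrimaryTorsion W p) h2 x

variable {W p κ} in
/-- `conj_γ y − y ∈ Sel ⟹ conj_{γ^k} y − y ∈ Sel` (induction; `Sel` is `Γ_K`-stable).
[cite: Castella2018, §2.1 (arXiv:1704.06608 p. 5)] -/
theorem conjH1_pow_sub_mem_selmerAc {𝔭 : HeightOneSpectrum (𝓞 K)}
    {S : Set (HeightOneSpectrum (𝓞 K))} (γ : absoluteGaloisGroup K)
    {y : W.subgroupH1 p κ.kerSubgroup}
    (hy : W.conjH1 p κ.kerSubgroup γ y - y ∈ selmerAc W p κ 𝔭 S) (k : ℕ) :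
    W.conjH1 p κ.kerSubgroup (γ ^ k) y - y ∈ selmerAc W p κ 𝔭 S := by
  induction k with
  | zero =>
    rw [pow_zero, W.conjH1_one_holds p κ.kerSubgroup, AddMonoidHom.id_apply, sub_self]
    exact zero_mem _
  | succ k ih =>
    have e : W.conjH1 p κ.kerSubgroup (γ ^ (k + 1)) y - y =
        (W.conjH1 p κ.kerSubgroup (γ ^ k) y - y) +
          W.conjH1 p κ.kerSubgroup (γ ^ k) (W.conjH1 p κ.kerSubgroup γ y - y) := by
      rw [pow_succ, W.conjH1_mul_holds p κ.kerSubgroup, AddMonoidHom.comp_apply, map_sub]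
      abel
    rw [e]
    exact add_mem ih (conjH1_mem_selmerAc _ hy)

variable {W p κ} in
/-- **All conjugates of `y` agree with `y` modulo `Sel`** when `conj_γ y − y ∈ Sel` for a
topological generator `γ`: `y` is fixed by a layer subgroup `Gal(K̄/K_a)`
(`exists_forall_mem_layerSubgroup_conjH1_eq`), and `Γ_K = Gal(K̄/K_a) γ^ℕ`.
[cite: JetchevSkinnerWan2017, Lemma 3.3.3 (arXiv:1512.06894 p. 12)]
[cite: SerreGaloisCohomology1997, I §2.6 (b)] -/
theorem conjH1_sub_mem_selmerAc_of_isTopGenerator {𝔭 : HeightOneSpectrum (𝓞 K)}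
    {S : Set (HeightOneSpectrum (𝓞 K))} {γ : absoluteGaloisGroup K} (hγ : κ.IsTopGenerator γ)
    {y : W.subgroupH1 p κ.kerSubgroup} (hy : W.conjH1 p κ.kerSubgroup γ y - y ∈ selmerAc W p κ 𝔭 S)
    (g : absoluteGaloisGroup K) : W.conjH1 p κ.kerSubgroup g y - y ∈ selmerAc W p κ 𝔭 S := by
  obtain ⟨a, ha⟩ := W.exists_forall_mem_layerSubgroup_conjH1_eq κ y
  obtain ⟨h, hh, k, rfl⟩ := exists_mem_layerSubgroup_mul_pow p κ hγ a g
  have e : W.conjH1 p κ.kerSubgroup (h * γ ^ k) y - y =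
      W.conjH1 p κ.kerSubgroup h (W.conjH1 p κ.kerSubgroup (γ ^ k) y - y) := by
    rw [W.conjH1_mul_holds p κ.kerSubgroup, AddMonoidHom.comp_apply, map_sub, ha h hh]
  rw [e]
  exact conjH1_mem_selmerAc _ (conjH1_pow_sub_mem_selmerAc γ hy k)

/-! ## §3. The local lifts `Ψ_v ∈ H¹(D_v, E[p^∞])` -/

variable {W p κ} in
/-- A Selmer class dies under `resKerD` at every place where `Sel` imposes the away / strict
condition (`v ∤ p`, `v ∉ Σ`, or `v = 𝔭`). [cite: Castella2018, Def. 2.2 (arXiv:1704.06608 p. 5)] -/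
theorem resKerD_eq_zero_of_mem_selmerAc {𝔭 : HeightOneSpectrum (𝓞 K)}
    {S : Set (HeightOneSpectrum (𝓞 K))} {v : HeightOneSpectrum (𝓞 K)}
    (hv : ((p : ℕ) : 𝓞 K) ∉ v.asIdeal ∧ v ∉ S ∨ v = 𝔭) {s : W.subgroupH1 p κ.kerSubgroup}
    (hs : s ∈ selmerAc W p κ 𝔭 S) : resKerD κ (W.geomPrimaryTorsion p) v s = 0 := by
  rw [← mem_awayKer_iff_resKerD_eq_zero]
  rcases hv with ⟨hpv, hvS⟩ | rfl
  · have h := ((mem_selmerOver_iff_awayKer _ _ s).1 hs).1 v hpv hvS 1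
    rwa [conjH1_one_holds, AddMonoidHom.id_apply] at h
  · have h := ((mem_selmerOver_iff_awayKer _ _ s).1 hs).2.2 1
    rwa [conjH1_one_holds, AddMonoidHom.id_apply] at h

variable {W p κ} in
/-- **The local lift (JSW17: "`H¹(K_w, W) → H¹(K_w, M)^Γ` is surjective").**  If all conjugates of
`y` agree with `y` modulo `Sel` and `Sel` imposes the away / strict condition at `v`, then
`res_{H ∩ D_v} y` is invariant under `conj_d`, `d ∈ D_v`, hence is the restriction of a class
`Ψ_v ∈ H¹(D_v, E[p^∞])` (engine (c) on the profinite `D_v` with `κ|_{D_v}`, image `0` or `p^a ℤ_p`).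
[cite: JetchevSkinnerWan2017, Lemma 3.3.3 (arXiv:1512.06894 p. 12)]
[cite: SerreGaloisCohomology1997, I §2.6 (b)] -/
theorem exists_resSubgroup_kerD_eq {𝔭 : HeightOneSpectrum (𝓞 K)} {S : Set (HeightOneSpectrum (𝓞 K))}
    (v : HeightOneSpectrum (𝓞 K)) (hv : ((p : ℕ) : 𝓞 K) ∉ v.asIdeal ∧ v ∉ S ∨ v = 𝔭)
    {y : W.subgroupH1 p κ.kerSubgroup}
    (hSel : ∀ g : absoluteGaloisGroup K, W.conjH1 p κ.kerSubgroup g y - y ∈ selmerAc W p κ 𝔭 S) :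
    ∃ z : subgroupH1 (decomp (K := K) v) (W.geomPrimaryTorsion p),
      ResKernel.resSubgroup (kerD κ v) (W.geomPrimaryTorsion p) z =
        resKerD κ (W.geomPrimaryTorsion p) v y := by
  haveI : CompactSpace (absoluteGaloisGroup K) := absoluteGaloisGroup_compactSpace K
  haveI : CompactSpace (decomp (K := K) v) :=
    isCompact_iff_compactSpace.mp (isClosed_decomp v).isCompact
  have hA : ∀ a : W.geomPrimaryTorsion p, IsOpen {d : decomp (K := K) v | d • a = a} := fun a ↦
    (isOpen_stabilizer_geomPrimaryTorsion W p a).preimage continuous_subtype_val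
  refine ProcyclicDescent.exists_resSubgroup_eq_of_forall_conjH1_eq hA (kappaD κ v)
    (isPrimaryTorsion_geomPrimaryTorsion W p) (resKerD κ _ v y) fun d ↦ ?_
  have e : W.conjH1 p κ.kerSubgroup (d : absoluteGaloisGroup K) y =
      y + (W.conjH1 p κ.kerSubgroup (d : absoluteGaloisGroup K) y - y) := by abel
  rw [← resKerD_conjH1, e, map_add, resKerD_eq_zero_of_mem_selmerAc hv (hSel _), add_zero]

variable {W p κ} in
/-- **At a good `v ∤ p` where the cocycle of `y` vanishes on inertia, `Ψ_v = 0` and `y` is locally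
trivial at the chosen place above `v`** (`H¹(D_v, E[p^∞]) ↪ H¹(I_v, E[p^∞])`, gen 11; `I_v ≤ H`:
`ℤ_p`-extensions are unramified at `v ∤ p`). [cite: GreenbergLNM1716, §3 Lemma 3.3 (p. 87)]
[cite: Washington1997, Prop. 13.2] -/
theorem eq_zero_of_inertia_le [W.IsElliptic] {v : HeightOneSpectrum (𝓞 K)}
    (hpv : ((p : ℕ) : 𝓞 K) ∉ v.asIdeal) (hgood : W.HasGoodReductionAt v)
    (φ : contOneCocycles (discreteTopRep κ.kerSubgroup (W.geomPrimaryTorsion p)))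
    {N₁ : Subgroup (absoluteGaloisGroup K)}
    (hN₁ : ∀ (h : absoluteGaloisGroup K) (hh : h ∈ κ.kerSubgroup), h ∈ N₁ → φ.1 ⟨h, hh⟩ = 0)
    (hI : (adicCompletionPrime K v).inertia (absoluteGaloisGroup K) ≤ N₁)
    (z : subgroupH1 (decomp (K := K) v) (W.geomPrimaryTorsion p))
    (hz : ResKernel.resSubgroup (kerD κ v) (W.geomPrimaryTorsion p) z =
      resKerD κ (W.geomPrimaryTorsion p) v (oneCocycleClass _ φ)) :
    z = 0 ∧ resKerD κ (W.geomPrimaryTorsion p) v (oneCocycleClass _ φ) = 0 := by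
  have hIH : (adicCompletionPrime K v).inertia (absoluteGaloisGroup K) ≤ κ.kerSubgroup :=
    ZpExtension.inertia_le_kerSubgroup_holds K p κ hpv (adicCompletionPrime_mem_primesAbove K v)
  have hy : resOfLe (W.geomPrimaryTorsion p) hIH (oneCocycleClass _ φ) = 0 :=
    resOfLe_oneCocycleClass_eq_zero_of_forall hIH φ fun i hi ↦ hN₁ i (hIH hi) (hI hi)
  have h0 : resOfLe (W.geomPrimaryTorsion p) (inertia_adicCompletionPrime_le_decomp v) z = 0 :=
    resOfLe_eq_zero_of_resSubgroup_kerD_eq κ v _ hIH _ z hz hy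
  have hz0 : z = 0 :=
    (resOfLe_inertia_injective_of_hasGoodReductionAt W p hpv hgood) (by rw [h0, map_zero])
  refine ⟨hz0, ?_⟩
  rw [← hz, hz0, map_zero]

end Summit.BirchSwinnertonDyer.Rank1Residual.X11b.Coinv

end
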